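import Literature.RepresentationTheory.ModularTensorCategories.ModularDatum

/-!
# The `SU(2)_k` recoupling data (labels `Fin (k+1)`, `a = 2j`): explicit closed forms

Topic `Literature/RepresentationTheory/ModularTensorCategories` (definition item `defn-ModularDatum`: the
data of the wanted instance `su2LevelK (k : ℕ) : ModularDatum` for route `QuantumFields/ModularSelfDualFold`).

Explicit closed forms at `q = e^{iπ/(k+2)}` (doubled labels `a ∈ {0,…,k}`):
* `Adm k a b c` — q-admissibility (parity, triangle, `a+b+c ≤ 2k`), `fusionN` the `{0,1}` multiplicities;
* `qInt k n = [n] = sin(nπ/(k+2))/sin(π/(k+2))`, `qFactorial`, `qdim a = [a+1]`;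
* `sMat a b = √(2/(k+2)) sin(π(a+1)(b+1)/(k+2))`, `twist a = exp(iπ a(a+2)/(2(k+2)))`,
  `rSym a b c = (-1)^{(a+b-c)/2} exp(iπ[c(c+2)-a(a+2)-b(b+2)]/(4(k+2)))`;
* `fSym a b c d e f = (-1)^{(a+b+c+d)/2} √([e+1][f+1]) {a/2 b/2 e/2; c/2 d/2 f/2}_q` with the q-6j symbol
  `sixJ` given by the Racah/Kauffman–Lins alternating sum `racahSum` and triangle coefficients
  `triangleSq` (unitary normalisation).

PROVED here: the fusion axioms except associativity (`fusionN_unit_left`, `_comm`, `_dual`,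
`_le_one`), `d_a > 0`, `|θ_a| = 1`, `|R| = 1`, trivial unit braiding, and the ribbon identity
`R^{ab}_c R^{ba}_c = θ_c/(θ_a θ_b)` (`rSym_mul_rSym`).

Deliberately NOT here (review of the first submission, D-0026): NO named fact bundling the deep
coherence identities and no conditional assembly `su2LevelK`. The remaining `ModularDatum` axioms
for these data — associativity of the truncated product, `d_a d_b = Σ N d_c`, unitarity of `sMat`,
`S² = 1`, Verlinde (finite trigonometric identities, to be PROVED in sibling files), and pentagon /
unitarity of `fSym`, hexagons, `θ` from `R`, balancing (Kauffman–Lins §7.3 Props. 9–10 in their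
normalisation, to be transported) — are left to sibling files; until then consumers quantify over
`C : ModularDatum (Fin (k+1))` with `C.S = sMat k`, … as explicit hypotheses of their own.
Evidence for the conventions (signs, chirality, normalisation): all `ModularDatum` axioms and
`HasSL2ZRelation` hold numerically for these closed forms for `k ≤ 5` to `10⁻¹⁵` (scripts in the
filing unit), and the `k = 1, 2` values agree with Rowell–Stong–Wang §5.3.1/§5.3.5 up to the gauge
`diag(1,-1)` on `F^{σσσ}_σ`.
-/

noncomputable section

open scoped ComplexConjugate Matrix
open Complex (I)

namespace Literature.RepresentationTheory.ModularTensorCategories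

namespace SU2LevelK

variable (k : ℕ)

/-- The quantum integer `[n] = sin(nπ/(k+2)) / sin(π/(k+2))` at `q = e^{iπ/(k+2)}`.
[cite: KauffmanLins1994, §9.4 (quantum integers [n], Δ_n; q = e^{iπ/r}, r = k + 2)] -/
def qInt (n : ℕ) : ℝ := Real.sin (n * Real.pi / (k + 2)) / Real.sin (Real.pi / (k + 2))

/-- The quantum factorial `[n]! = [1][2]⋯[n]`. [cite: KauffmanLins1994, §9.4 and §9.10 (q-factorials [n]! in the θ-net formula)] -/
def qFactorial (n : ℕ) : ℝ := ∏ m ∈ Finset.range n, qInt k (m + 1)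

/-- Level-`k` admissibility of a triple of labels `a = 2j₁, b = 2j₂, c = 2j₃ ∈ ℕ` (truncated
Clebsch–Gordan rule): `a + b + c` even, triangle inequalities, and `a + b + c ≤ 2k = 2r - 4`
(Kauffman–Lins' q-admissibility). [cite: KauffmanLins1994, §7.1 (q-admissible triples (i)–(iii))]
[cite: Gannon2023, eq. (6.2.2c) (A₁ level-k fusion rule)] -/
def Adm (a b c : ℕ) : Prop := (a + b + c) % 2 = 0 ∧ c ≤ a + b ∧ a ≤ b + c ∧ b ≤ c + a ∧ a + b + c ≤ 2 * k

/-- Admissibility is decidable. [folklore] -/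
instance instDecidableAdm (a b c : ℕ) : Decidable (Adm k a b c) := by unfold Adm; infer_instance

/-- Fusion multiplicities `N_{ab}^c ∈ {0,1}` of `SU(2)_k`. [cite: Gannon2023, eq. (6.2.2c)] -/
def fusionN (a b c : Fin (k + 1)) : ℕ := if Adm k a b c then 1 else 0

/-- Quantum dimensions `d_a = [a+1]`. [cite: RowellStongWang2007, §5.3.5 ((A₁,2): quantum dimensions (1, √2, 1))] -/
def qdim (a : Fin (k + 1)) : ℝ := qInt k (a + 1)

/-- The S-matrix `S_{ab} = √(2/(k+2)) sin(π(a+1)(b+1)/(k+2))`. [cite: Gannon2023, eq. (6.2.2a)] -/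
def sMat : Matrix (Fin (k + 1)) (Fin (k + 1)) ℂ := Matrix.of fun a b =>
  ((Real.sqrt (2 / (k + 2)) * Real.sin (Real.pi * ((a : ℕ) + 1) * ((b : ℕ) + 1) / (k + 2)) : ℝ) : ℂ)

/-- The twist exponent `h_a = a(a+2)/(4(k+2))` (conformal weight of spin `a/2`), so that
`θ_a = exp(2πi h_a)`. [cite: Gannon2023, eq. (6.2.2b) (T_aa up to the central-charge phase)] -/
def twistArg (a : ℕ) : ℝ := Real.pi * (a * (a + 2)) / (2 * (k + 2))

/-- Twists `θ_a = exp(iπ a(a+2) / (2(k+2)))`. [cite: RowellStongWang2007, §5.3.1, §5.3.5 (θ_s = i for k = 1; θ = (1, e^{3πi/8}, -1) for k = 2)] -/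
def twist (a : Fin (k + 1)) : ℂ := Complex.exp ((twistArg k a : ℝ) * I)

/-- R-symbols `R^{ab}_c = (-1)^{(a+b-c)/2} exp(iπ [c(c+2) - a(a+2) - b(b+2)] / (4(k+2)))` on
admissible channels (there `c ≤ a + b`, so the `ℕ`-subtraction is exact), `0` otherwise — the
complex conjugate (mirror) of Kauffman–Lins' vertex twist `λ^{ab}_c = (-1)^{(a+b-c)/2} A^{(a'+b'-c')/2}`,
`x' = x(x+2)`, `A = e^{iπ/(2(k+2))}`; agrees with the printed semion and `(A₁,2)` braidings.
[cite: KauffmanLins1994, §9.9 (λ^{ab}_c)] [cite: RowellStongWang2007, §5.3.1, §5.3.5 (R^{ss}_1 = i; (A₁,2): R^{σσ}_1 = -e^{-3πi/8}, R^{σσ}_ψ = e^{πi/8})] -/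
def rSym (a b c : Fin (k + 1)) : ℂ :=
  if Adm k a b c then
    (-1 : ℂ) ^ (((a : ℕ) + b - c) / 2) * Complex.exp (((twistArg k c - twistArg k a - twistArg k b) / 2 : ℝ) * I)
  else 0

/-- The square `Δ(a,b,c)²` of the triangle coefficient, in doubled labels:
`[(b+c-a)/2]! [(a+c-b)/2]! [(a+b-c)/2]! / [(a+b+c)/2 + 1]!` (meaningful on triangles; the
unitary renormalisation of Kauffman–Lins' θ-net `θ(a,b,c)`). [cite: KauffmanLins1994, §9.10 (θ-net formula)] -/
def triangleSq (a b c : ℕ) : ℝ :=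
  qFactorial k ((b + c - a) / 2) * qFactorial k ((a + c - b) / 2) * qFactorial k ((a + b - c) / 2) /
    qFactorial k ((a + b + c) / 2 + 1)

/-- The Racah sum of the q-deformed Racah–Wigner 6j-symbol `{j₁ j₂ j₁₂; j₃ j j₂₃}` in doubled
labels: `Σ_z (-1)^z [z+1]! / ([z-α₁]! [z-α₂]! [z-α₃]! [z-α₄]! [β₁-z]! [β₂-z]! [β₃-z]!)` over
`max αᵢ ≤ z ≤ min βⱼ`, `α₁ = j₁+j₂+j₁₂, α₂ = j₁₂+j₃+j, α₃ = j₂+j₃+j₂₃, α₄ = j₁+j₂₃+j`,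
`β₁ = j₁+j₂+j₃+j, β₂ = j₁+j₁₂+j₃+j₂₃, β₃ = j₂+j₁₂+j+j₂₃` (all halved doubled labels) — the same
alternating sum as in Kauffman–Lins' closed formula for the tetrahedral net.
[cite: KauffmanLins1994, §9.11 (Tet: Σ_s (-1)^s [s+1]! / Π[s-aᵢ]! Π[bⱼ-s]!)] -/
def racahSum (a b e c d f : ℕ) : ℝ :=
  let α₁ := (a + b + e) / 2
  let α₂ := (e + c + d) / 2
  let α₃ := (b + c + f) / 2
  let α₄ := (a + f + d) / 2
  let β₁ := (a + b + c + d) / 2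
  let β₂ := (a + e + c + f) / 2
  let β₃ := (b + e + d + f) / 2
  ∑ z ∈ Finset.Icc (max (max α₁ α₂) (max α₃ α₄)) (min (min β₁ β₂) β₃),
    (-1 : ℝ) ^ z * qFactorial k (z + 1) /
      (qFactorial k (z - α₁) * qFactorial k (z - α₂) * qFactorial k (z - α₃) * qFactorial k (z - α₄) *
        qFactorial k (β₁ - z) * qFactorial k (β₂ - z) * qFactorial k (β₃ - z))

/-- The q-deformed Racah–Wigner 6j-symbol `{a/2 b/2 e/2; c/2 d/2 f/2}_q` (doubled labels), i.e. the
Kauffman–Lins q-6j symbol `Tet·Δ_e/(θθ)` in the symmetric (unitary, Kirillov–Reshetikhin)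
normalisation. [cite: KauffmanLins1994, §9.11–9.12 (Tet and the q-6j symbols)] -/
def sixJ (a b e c d f : ℕ) : ℝ :=
  Real.sqrt (triangleSq k a b e * triangleSq k e c d * triangleSq k b c f * triangleSq k a f d) *
    racahSum k a b e c d f

/-- F-symbols of `SU(2)_k` in the unitary normalisation:
`[F^{abc}_d]_{ef} = (-1)^{(a+b+c+d)/2} √([e+1][f+1]) {a/2 b/2 e/2; c/2 d/2 f/2}_q` on admissible
labellings, `0` otherwise; agrees (up to the gauge `diag(1,-1)` on `F^{σσσ}_σ`) with the printed semion
and `(A₁,2)` F-matrices. [cite: KauffmanLins1994, §9.12 (q-6j symbols)]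
[cite: RowellStongWang2007, §5.3.1, §5.3.5 (F^{sss}_s = -1; (A₁,2) F-matrices)] -/
def fSym (a b c d e f : Fin (k + 1)) : ℂ :=
  if Adm k a b e ∧ Adm k e c d ∧ Adm k b c f ∧ Adm k a f d then
    (((-1 : ℝ) ^ (((a : ℕ) + b + c + d) / 2) * Real.sqrt (qInt k (e + 1) * qInt k (f + 1)) *
      sixJ k a b e c d f : ℝ) : ℂ)
  else 0

/-! ### Elementary properties proved here -/

/-- Admissibility is symmetric in the first two labels. [folklore] -/
theorem adm_comm {a b c : ℕ} : Adm k a b c ↔ Adm k b a c := by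
  unfold Adm; omega

/-- `(0, b, c)` is admissible iff `b = c` (`b ≤ k`). [folklore] -/
theorem adm_zero_left {b c : ℕ} (hb : b ≤ k) : Adm k 0 b c ↔ b = c := by
  unfold Adm; omega

/-- `(a, b, 0)` is admissible iff `b = a` (`a ≤ k`). [folklore] -/
theorem adm_zero_right {a b : ℕ} (ha : a ≤ k) : Adm k a b 0 ↔ b = a := by
  unfold Adm; omega

/-- `0 < [n]` for `1 ≤ n ≤ k + 1`. [folklore] -/
theorem qInt_pos {n : ℕ} (h1 : 1 ≤ n) (h2 : n ≤ k + 1) : 0 < qInt k n := by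
  unfold qInt
  have hk : (0 : ℝ) < k + 2 := by positivity
  apply div_pos
  · apply Real.sin_pos_of_pos_of_lt_pi
    · positivity
    · rw [div_lt_iff₀ hk]
      have : (n : ℝ) ≤ k + 1 := by exact_mod_cast h2
      nlinarith [Real.pi_pos]
  · apply Real.sin_pos_of_pos_of_lt_pi
    · positivity
    · rw [div_lt_iff₀ hk]
      nlinarith [Real.pi_pos]

/-- `d_a = [a+1] > 0`. [folklore] -/
theorem qdim_pos (a : Fin (k + 1)) : 0 < qdim k a :=
  qInt_pos k (by omega) (by have := a.isLt; omega)

/-- `|θ_a| = 1`. [folklore] -/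
theorem norm_twist (a : Fin (k + 1)) : ‖twist k a‖ = 1 := by
  unfold twist; exact Complex.norm_exp_ofReal_mul_I _

/-- `N_{0b}^c = δ_{bc}`. [folklore] -/
theorem fusionN_unit_left (b c : Fin (k + 1)) : fusionN k 0 b c = if b = c then 1 else 0 := by
  unfold fusionN
  have hb : (b : ℕ) ≤ k := by have := b.isLt; omega
  simp only [Fin.val_zero, adm_zero_left k hb, Fin.val_inj]

/-- `N_{ab}^c = N_{ba}^c`. [folklore] -/
theorem fusionN_comm (a b c : Fin (k + 1)) : fusionN k a b c = fusionN k b a c := by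
  unfold fusionN
  by_cases h : Adm k a b c
  · rw [if_pos h, if_pos ((adm_comm k).mp h)]
  · rw [if_neg h, if_neg (fun h' => h ((adm_comm k).mpr h'))]

/-- `N_{ab}^0 = δ_{ab}` (all labels self-dual). [folklore] -/
theorem fusionN_dual (a b : Fin (k + 1)) : fusionN k a b 0 = if b = a then 1 else 0 := by
  unfold fusionN
  have ha : (a : ℕ) ≤ k := by have := a.isLt; omega
  simp only [Fin.val_zero, adm_zero_right k ha, Fin.val_inj]

/-- Multiplicity-freeness. [folklore] -/
theorem fusionN_le_one (a b c : Fin (k + 1)) : fusionN k a b c ≤ 1 := by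
  unfold fusionN; split_ifs <;> norm_num

/-- `N_{ab}^c ≠ 0 ↔ (a,b,c)` admissible. [folklore] -/
theorem fusionN_ne_zero_iff {a b c : Fin (k + 1)} : fusionN k a b c ≠ 0 ↔ Adm k a b c := by
  unfold fusionN; split_ifs with h <;> simp [h]

/-- `|R^{ab}_c| = 1` on admissible channels. [folklore] -/
theorem norm_rSym {a b c : Fin (k + 1)} (h : Adm k a b c) : ‖rSym k a b c‖ = 1 := by
  unfold rSym; rw [if_pos h, norm_mul, Complex.norm_exp_ofReal_mul_I, norm_pow, norm_neg, norm_one,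
    one_pow, one_mul]

/-- `R^{0a}_a = 1`. [folklore] -/
theorem rSym_zero_left (a : Fin (k + 1)) : rSym k 0 a a = 1 := by
  have ha : (a : ℕ) ≤ k := by have := a.isLt; omega
  have h : Adm k (0 : Fin (k + 1)) a a := by rw [Fin.val_zero, adm_zero_left k ha]
  unfold rSym; rw [if_pos h]
  simp [twistArg]

/-- `R^{a0}_a = 1`. [folklore] -/
theorem rSym_zero_right (a : Fin (k + 1)) : rSym k a 0 a = 1 := by
  have ha : (a : ℕ) ≤ k := by have := a.isLt; omega
  have h : Adm k a (0 : Fin (k + 1)) a := by rw [Fin.val_zero, show Adm k a 0 a ↔ Adm k 0 a a from adm_comm k, adm_zero_left k ha]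
  unfold rSym; rw [if_pos h]
  simp [twistArg]

/-- The ribbon identity `R^{ab}_c R^{ba}_c = θ_c/(θ_a θ_b)` for `SU(2)_k` (elementary).
[cite: Kitaev2006, App. E.3 (R^{ba}R^{ab} = θ_c/(θ_aθ_b))] -/
theorem rSym_mul_rSym {a b c : Fin (k + 1)} (h : Adm k a b c) :
    rSym k a b c * rSym k b a c = twist k c / (twist k a * twist k b) := by
  have h' : Adm k b a c := (adm_comm k).mp h
  have hsub : ((b : ℕ) + a - c) / 2 = ((a : ℕ) + b - c) / 2 := by rw [Nat.add_comm]
  unfold rSym twist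
  rw [if_pos h, if_pos h', hsub]
  have hsq : ((-1 : ℂ) ^ (((a : ℕ) + b - c) / 2)) * ((-1 : ℂ) ^ (((a : ℕ) + b - c) / 2)) = 1 := by
    rw [← mul_pow, neg_one_mul, neg_neg, one_pow]
  rw [eq_div_iff (mul_ne_zero (Complex.exp_ne_zero _) (Complex.exp_ne_zero _))]
  calc _ = ((-1 : ℂ) ^ (((a : ℕ) + b - c) / 2) * (-1 : ℂ) ^ (((a : ℕ) + b - c) / 2)) *
        (Complex.exp (((twistArg k c - twistArg k a - twistArg k b) / 2 : ℝ) * I) *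
          Complex.exp (((twistArg k c - twistArg k b - twistArg k a) / 2 : ℝ) * I) *
          (Complex.exp ((twistArg k a : ℝ) * I) * Complex.exp ((twistArg k b : ℝ) * I))) := by ring
    _ = _ := by
      rw [hsq, one_mul, ← Complex.exp_add, ← Complex.exp_add, ← Complex.exp_add]
      congr 1
      push_cast
      ring

end SU2LevelK

end Literature.RepresentationTheory.ModularTensorCategories
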